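import Literature.Analysis.FunctionSpaces.SpinorWightmanTwoPoint
import Literature.MathematicalPhysics.QuantumLattice.SchwartzTranslationCutoff
import HarnessLib

/-!
# Spinor Wightman fields: a linear combination of components annihilating the vacuum vanishes
(Streater–Wightman Thm. 4-3 for combinations)

Topic `Literature/Analysis/FunctionSpaces`. `SpinorWightmanVanishing` proves Streater–Wightman's
Thm. 4-3 (1964, §4-2) for a single component: `φ_{i₀}(g) Ω = 0 ∀ g ⇒ φ_{i₀} = 0`. The PCT theorem
(`pct_theorem`, §4-3 Thm. 4-7) needs it for **linear combinations**
`X(g) = ∑ₐ cₐ φ_{iₐ}(g)` of components with a common Bose/Fermi flag (the wrong-parity parts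
`∑_β P_{αβ} φ_{k,β}` of a reducible multiplet): such an `X` is again local relative to all fields,
with a uniform sign, and the printed proof applies verbatim —

* `combField_cMonomial_comm` — `X(g) φ(l) ψ = ± φ(l) X(g) ψ` for far separated supports;
* `inner_combField_cmonomialVec_eq_zero` — if `X(g) Ω = 0` for all `g` then
  `⟪Ψ, X(f₀) φ(f₁) ⋯ φ(fₙ) Ω⟫ = 0` (the combination of the vector distributions of `Ψ` is the
  boundary value of the combination of their tube functions, vanishes near a totally spacelike
  configuration, hence on compactly supported test functions by S–W Thm. 2-17
  (`eq_zero_of_rayBoundaryValue_zero_of_isOpen`) and the local totality of tensor products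
  (`clm_eq_zero_of_tsupport_subset_box`), hence everywhere by density);
* `combField_eq_zero_of_vacuum_eq_zero` — **`X = 0` on `D`** (Steps 2–4 of the printed proof: the
  adjoint combination annihilates `D`, W4, hermiticity).

## References

* R. F. Streater, A. S. Wightman, *PCT, Spin and Statistics, and All That* (1964; Princeton 2000),
  §4-2 Thms. 4-2, 4-3. [StreaterWightman1964]
-/

noncomputable section

open Filter MeasureTheory Set ComplexConjugate Complex
open _root_.Topology
open scoped InnerProductSpace SchwartzMap ContDiff
open Literature.MathematicalPhysics Literature.MathematicalPhysics.QuantumLattice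

namespace Literature.Analysis.FunctionSpaces

variable {κ : Type*}

section LocalDensity

variable {n : ℕ}

/-- Local copy of `clm_eq_zero_of_tsupport_subset_box` (`SpinorWightmanPCTLocality`), kept private to make this file independent of that module: if a
continuous linear functional `L` on `𝒮((ℝ⁴)ⁿ)` vanishes on the tensor products `⊗ fⱼ` of compactly
supported test functions with `supp fⱼ ⊆ 𝒪ⱼ`, `𝒪ⱼ` open, then `L F = 0` for every compactly supported
`F` supported in `{x | xⱼ ∈ 𝒪ⱼ ∀ j}` (cutoffs `θⱼ ∈ C_c^∞(𝒪ⱼ)` equal to `1` near the projections of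
`supp F`, `F = (⊗θⱼ) · F`, and totality of tensor products; the functional form of
`IsSpinorVectorDistributionOf.apply_eq_zero_of_tsupport_subset_pi`). [folklore] -/
private theorem clm_eq_zero_of_tsupport_subset_box' (L : 𝓢((Fin n → SpaceTime 3), ℂ) →L[ℂ] ℂ)
    {O : Fin n → Set (SpaceTime 3)} (hO : ∀ j, IsOpen (O j))
    (h0 : ∀ (f : Fin n → 𝓢(SpaceTime 3, ℂ)) (G : 𝓢((Fin n → SpaceTime 3), ℂ)), IsTensorOf G f →
      (∀ j, HasCompactSupport (f j : SpaceTime 3 → ℂ) ∧ tsupport (f j : SpaceTime 3 → ℂ) ⊆ O j) → L G = 0)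
    (F : 𝓢((Fin n → SpaceTime 3), ℂ)) (hFc : HasCompactSupport (F : (Fin n → SpaceTime 3) → ℂ))
    (hFO : tsupport (F : (Fin n → SpaceTime 3) → ℂ) ⊆ {x | ∀ j, x j ∈ O j}) : L F = 0 := by
  -- the coordinate projections of the support and cutoffs `θⱼ = 1` on them
  set K : Fin n → Set (SpaceTime 3) := fun j => (fun x : Fin n → SpaceTime 3 => x j) ''
    tsupport (F : (Fin n → SpaceTime 3) → ℂ) with hK
  have hKc : ∀ j, IsCompact (K j) := fun j => hFc.image (continuous_apply j)
  have hKO : ∀ j, K j ⊆ O j := by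
    rintro j y ⟨x, hx, rfl⟩
    exact hFO hx j
  choose θ hθs hθc hθO hθ1 _ using fun j =>
    SchwartzSupport.exists_smooth_one_of_isCompact_subset_isOpen (hKc j) (hO j) (hKO j)
  -- the complex one-variable cutoffs and the tensor cutoff
  set θc : Fin n → SpaceTime 3 → ℂ := fun j y => ((θ j y : ℝ) : ℂ) with hθc_def
  have hθcs : ∀ j, ContDiff ℝ ∞ (θc j) := fun j => Complex.ofRealCLM.contDiff.comp (hθs j)
  have hθcc : ∀ j, HasCompactSupport (θc j) := fun j => (hθc j).comp_left Complex.ofReal_zero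
  have hθcg : ∀ j, (θc j).HasTemperateGrowth := fun j => (hθcc j).hasTemperateGrowth (hθcs j)
  have hθct : ∀ j, tsupport (θc j) ⊆ O j := fun j =>
    (closure_mono (Function.support_comp_subset Complex.ofReal_zero (θ j))).trans (hθO j)
  set m : (Fin n → SpaceTime 3) → ℂ := fun x => ∏ j, θc j (x j) with hm_def
  have hms : ContDiff ℝ ∞ m :=
    contDiff_prod fun j _ => (hθcs j).comp (contDiff_pi.1 contDiff_id j)
  have hmc : HasCompactSupport m := by
    refine HasCompactSupport.of_support_subset_isCompact (isCompact_univ_pi fun j : Fin n => hθcc j)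
      fun x hx => ?_
    rw [Function.mem_support, hm_def, Finset.prod_ne_zero_iff] at hx
    exact fun j _ => subset_tsupport _ (hx j (Finset.mem_univ j))
  have hmg : m.HasTemperateGrowth := hmc.hasTemperateGrowth hms
  -- `(⊗θ) · F = F`
  have hmF : SchwartzMap.smulLeftCLM ℂ m F = F := by
    ext x
    rw [SchwartzMap.smulLeftCLM_apply_apply hmg, smul_eq_mul]
    by_cases hx : x ∈ tsupport (F : (Fin n → SpaceTime 3) → ℂ)
    · have h1 : m x = 1 := by
        rw [hm_def]
        refine Finset.prod_eq_one fun j _ => ?_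
        simp only [hθc_def]
        rw [hθ1 j (x j) ⟨x, hx, rfl⟩, Complex.ofReal_one]
      rw [h1, one_mul]
    · rw [image_eq_zero_of_notMem_tsupport hx, mul_zero]
  -- the functional `L ∘ ((⊗θ) · )` vanishes on all tensor products, hence everywhere
  set L' : 𝓢((Fin n → SpaceTime 3), ℂ) →L[ℂ] ℂ := L.comp (SchwartzMap.smulLeftCLM ℂ m) with hL'
  have hL0 : L' = 0 := by
    refine ContinuousLinearMap.ext_on (denseSpan_tensorProducts_holds (E := SpaceTime 3) n)
      fun G hG => ?_
    obtain ⟨g, hg⟩ := hG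
    set h : Fin n → 𝓢(SpaceTime 3, ℂ) := fun j => SchwartzMap.smulLeftCLM ℂ (θc j) (ofRealTest (g j))
      with hh
    have hten : IsTensorOf (SchwartzMap.smulLeftCLM ℂ m G) h := by
      intro x
      rw [SchwartzMap.smulLeftCLM_apply_apply hmg, smul_eq_mul, hg x, hm_def]
      dsimp only
      rw [← Finset.prod_mul_distrib]
      refine Finset.prod_congr rfl fun j _ => ?_
      rw [hh]
      dsimp only
      rw [SchwartzMap.smulLeftCLM_apply_apply (hθcg j), smul_eq_mul]
    have hloc : ∀ j, HasCompactSupport (h j : SpaceTime 3 → ℂ) ∧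
        tsupport (h j : SpaceTime 3 → ℂ) ⊆ O j := by
      intro j
      have hfun : (h j : SpaceTime 3 → ℂ) = fun y => θc j y • ofRealTest (g j) y := by
        funext y
        rw [hh]
        exact SchwartzMap.smulLeftCLM_apply_apply (hθcg j) _ y
      rw [hfun]
      exact ⟨(hθcc j).smul_right, (tsupport_smul_subset_left _ _).trans (hθct j)⟩
    change L' G = 0
    rw [hL', ContinuousLinearMap.comp_apply]
    exact h0 h _ hten hloc
  have h := congrArg (fun S : 𝓢((Fin n → SpaceTime 3), ℂ) →L[ℂ] ℂ => S F) hL0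
  simp only [hL', ContinuousLinearMap.comp_apply, hmF, zero_apply] at h
  exact h

end LocalDensity

namespace SpinorWightmanData

variable (W : SpinorWightmanData κ) {m : ℕ}

/-- A **linear combination of field components** smeared with one test function,
`X(g) = ∑ₐ cₐ φ_{iₐ}(g)`, as an operator on `D`. [cite: StreaterWightman1964, §4-2 Thm 4-3] -/
def combField (c : Fin m → ℂ) (i : Fin m → W.Idx) (g : 𝓢(SpaceTime 3, ℂ)) : W.dom →ₗ[ℂ] W.dom :=
  ∑ a, c a • W.cfield (i a) g

/-- Unfolding `combField`. [folklore] -/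
theorem combField_apply (c : Fin m → ℂ) (i : Fin m → W.Idx) (g : 𝓢(SpaceTime 3, ℂ)) (ψ : W.dom) :
    W.combField c i g ψ = ∑ a, c a • W.cfield (i a) g ψ := by
  simp [combField]

end SpinorWightmanData

namespace IsSpinorWightmanQFT

open SpinorWightmanData

variable {W : SpinorWightmanData κ} {m n : ℕ}

/-- **A uniform-flag combination is local relative to all monomials**: for far separated supports
`X(g) φ(l) ψ = ± φ(l) X(g) ψ` with the sign of any of its members. [cite: StreaterWightman1964, §3-1 eq. (3-6)] -/
theorem combField_cMonomial_comm (hW : IsSpinorWightmanQFT W) (c : Fin m → ℂ) (i : Fin m → W.Idx)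
    (hflag : ∀ a b, W.isFermi (i a).1 = W.isFermi (i b).1) (a₀ : Fin m) (g : 𝓢(SpaceTime 3, ℂ))
    (l : List W.CLetter) (ψ : W.dom)
    (h : ∀ p ∈ l, AreSpacelikeSeparated (tsupport (g : SpaceTime 3 → ℂ)) (tsupport (p.2 : SpaceTime 3 → ℂ))) :
    W.combField c i g (W.cMonomial l ψ) =
      (l.map fun p => W.localitySign (i a₀) p.1).prod • W.cMonomial l (W.combField c i g ψ) := by
  rw [combField_apply, combField_apply, map_sum, Finset.smul_sum]
  refine Finset.sum_congr rfl fun a _ => ?_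
  rw [hW.cfield_cMonomial_comm (i a) g l ψ h, map_smul, smul_comm]
  congr 2
  refine List.map_congr_left fun p _ => ?_
  simp [SpinorWightmanData.localitySign, hflag a a₀]

/-- **Step 1 for combinations.** If `X(g) Ω = 0` for all `g`, then
`⟪Ψ, X(f₀) φ_{i₁}(f₁) ⋯ φ_{iₙ}(fₙ) Ω⟫ = 0`. [cite: StreaterWightman1964, §4-2 Thms 4-2, 4-3] -/
theorem inner_combField_cmonomialVec_eq_zero (hW : IsSpinorWightmanQFT W) (c : Fin m → ℂ) (i : Fin m → W.Idx)
    (hflag : ∀ a b, W.isFermi (i a).1 = W.isFermi (i b).1)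
    (h0 : ∀ g : 𝓢(SpaceTime 3, ℂ), W.combField c i g W.vacuumDom = 0) (Ψ : W.H)
    (f₀ : 𝓢(SpaceTime 3, ℂ)) (i' : Fin n → W.Idx) (f : Fin n → 𝓢(SpaceTime 3, ℂ)) :
    ⟪Ψ, (W.combField c i f₀ (W.cmonomialVec (List.ofFn fun j => (i' j, f j))) : W.H)⟫_ℂ = 0 := by
  rcases isEmpty_or_nonempty (Fin m) with hm | ⟨⟨a₀⟩⟩
  · rw [combField_apply]
    simp
  -- the vector distributions of `Ψ` with letters `(i a, i'₁, …, i'ₙ)`, their tube functions, and the combinations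
  set T : Fin m → (𝓢((Fin (n + 1) → SpaceTime 3), ℂ) →L[ℂ] ℂ) := fun a =>
    hW.vectorDistribution Ψ (n + 1) (Fin.cons (i a) i') with hTdef
  have hT : ∀ a, IsSpinorVectorDistributionOf W Ψ (n + 1) (Fin.cons (i a) i') (T a) := fun a =>
    hW.isSpinorVectorDistributionOf_vectorDistribution Ψ (n + 1) _
  choose G hG hbv using fun a => (hT a).exists_tubeFunction hW
  set Tc : 𝓢((Fin (n + 1) → SpaceTime 3), ℂ) →L[ℂ] ℂ := ∑ a, c a • T a with hTc
  set Gc : (Fin (n + 1) → Fin (3 + 1) → ℂ) → ℂ := fun z => ∑ a, c a * G a z with hGc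
  have hGc_diff : DifferentiableOn ℂ Gc (forwardTube 3 (n + 1)) :=
    DifferentiableOn.fun_sum fun a _ => (hG a).const_mul (c a)
  -- `Tc` on tensor products is `⟪Ψ, X(g₀) φ(g₁) ⋯ Ω⟫`
  have hTc_ten : ∀ (g : Fin (n + 1) → 𝓢(SpaceTime 3, ℂ)) (F : 𝓢((Fin (n + 1) → SpaceTime 3), ℂ)), IsTensorOf F g →
      Tc F = ⟪Ψ, (W.combField c i (g 0) (W.cmonomialVec (List.ofFn fun j => (i' j, g j.succ))) : W.H)⟫_ℂ := by
    intro g F hF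
    rw [hTc, sum_apply, combField_apply, Submodule.coe_sum, inner_sum]
    refine Finset.sum_congr rfl fun a _ => ?_
    rw [smul_apply, hT a g F hF, Submodule.coe_smul, inner_smul_right, smul_eq_mul]
    congr 1
    have hg' : (List.ofFn fun j => ((Fin.cons (i a) i' : Fin (n + 1) → W.Idx) j, g j)) =
        (i a, g 0) :: List.ofFn fun j => (i' j, g j.succ) := by
      rw [List.ofFn_succ]; rfl
    rw [hg', cmonomialVec_cons]
  -- the regions: `x₀` near `x⋆`, the others near `0`
  set O : Fin (n + 1) → Set (SpaceTime 3) :=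
    Fin.cons (Metric.ball farPoint 1) (fun _ => Metric.ball (0 : SpaceTime 3) 1) with hO
  have hOo : ∀ j, IsOpen (O j) := fun j => by
    refine Fin.cases ?_ (fun j => ?_) j
    · simp only [hO, Fin.cons_zero]; exact Metric.isOpen_ball
    · simp only [hO, Fin.cons_succ]; exact Metric.isOpen_ball
  -- `Tc` vanishes on local tensor products
  have hten : ∀ (g : Fin (n + 1) → 𝓢(SpaceTime 3, ℂ)) (F : 𝓢((Fin (n + 1) → SpaceTime 3), ℂ)), IsTensorOf F g →
      (∀ j, HasCompactSupport (g j : SpaceTime 3 → ℂ) ∧ tsupport (g j : SpaceTime 3 → ℂ) ⊆ O j) → Tc F = 0 := by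
    intro g F hF hg
    rw [hTc_ten g F hF]
    have hsep : ∀ p ∈ (List.ofFn fun j : Fin n => (i' j, g j.succ)),
        AreSpacelikeSeparated (tsupport (g 0 : SpaceTime 3 → ℂ)) (tsupport (p.2 : SpaceTime 3 → ℂ)) := by
      intro p hp
      rw [List.mem_ofFn] at hp
      obtain ⟨j, rfl⟩ := hp
      have h₀ := (hg 0).2
      have hⱼ := (hg j.succ).2
      simp only [hO, Fin.cons_zero, Fin.cons_succ] at h₀ hⱼ
      exact fun x hx y hy => areSpacelikeSeparated_farBall_ball x (h₀ hx) y (hⱼ hy)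
    have hvec : W.combField c i (g 0) (W.cmonomialVec (List.ofFn fun j : Fin n => (i' j, g j.succ))) = 0 := by
      rw [cmonomialVec, hW.combField_cMonomial_comm c i hflag a₀ (g 0) _ W.vacuumDom hsep, h0, map_zero, smul_zero]
    rw [hvec, Submodule.coe_zero, inner_zero_right]
  -- the open set of configurations
  set E : Set (Fin (n + 1) → SpaceTime 3) := {x | ∀ j, x j ∈ O j} with hE
  have hEo : IsOpen E := by
    have : E = ⋂ j, (fun x : Fin (n + 1) → SpaceTime 3 => x j) ⁻¹' O j := by
      ext x; simp [hE]
    rw [this]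
    exact isOpen_iInter_of_finite fun j => (hOo j).preimage (continuous_apply j)
  have hEne : E.Nonempty := by
    refine ⟨Fin.cons farPoint fun _ => 0, fun j => ?_⟩
    refine Fin.cases ?_ (fun j => ?_) j
    · simp [hO]
    · simp [hO]
  have hTE : ∀ F : 𝓢((Fin (n + 1) → SpaceTime 3), ℂ), HasCompactSupport (F : (Fin (n + 1) → SpaceTime 3) → ℂ) →
      tsupport (F : (Fin (n + 1) → SpaceTime 3) → ℂ) ⊆ E → Tc F = 0 :=
    fun F hFc hFE => clm_eq_zero_of_tsupport_subset_box' Tc hOo hten F hFc hFE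
  -- the ray boundary values of `Gc` on compactly supported test functions are `Tc`
  have hray : ∀ η ∈ tubeCone 3 (n + 1), ∀ F : 𝓢((Fin (n + 1) → SpaceTime 3), ℂ),
      HasCompactSupport (F : (Fin (n + 1) → SpaceTime 3) → ℂ) →
      Tendsto (fun t : ℝ => ∫ x : Fin (n + 1) → SpaceTime 3,
        Gc (fun k => complexifyPoint (x k) + ((t : ℂ) * I) • complexifyPoint (η k)) * F x) (𝓝[>] 0) (𝓝 (Tc F)) := by
    intro η hη F hFc
    have hlim : Tendsto (fun t : ℝ => ∑ a, c a * ∫ x : Fin (n + 1) → SpaceTime 3,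
        G a (fun k => complexifyPoint (x k) + ((t : ℂ) * I) • complexifyPoint (η k)) * F x) (𝓝[>] 0) (𝓝 (Tc F)) := by
      have : Tc F = ∑ a, c a * T a F := by rw [hTc, sum_apply]; simp
      rw [this]
      exact tendsto_finsetSum _ fun a _ => (hbv a η hη F).const_mul (c a)
    refine hlim.congr' ?_
    filter_upwards [self_mem_nhdsWithin] with t ht
    have hint := fun a => integrable_ray_mul (hG a) hη ht hFc
    simp_rw [← integral_const_mul]
    rw [← integral_finsetSum _ fun a _ => (hint a).const_mul (c a)]
    refine integral_congr_ae (Eventually.of_forall fun x => ?_)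
    simp only [hGc, Finset.sum_mul, mul_assoc]
  -- `Gc = 0` on the forward tube (S–W Thm. 2-17)
  have hG0 : ∀ z ∈ forwardTube 3 (n + 1), Gc z = 0 := fun z hz =>
    eq_zero_of_rayBoundaryValue_zero_of_isOpen hGc_diff hEo hEne (fun η hη F hFc hFE => by
      have h := hray η hη F hFc
      rwa [hTE F hFc hFE] at h) hz
  -- hence `Tc = 0` on compactly supported test functions, hence everywhere
  have hTc0' : ∀ F : 𝓢((Fin (n + 1) → SpaceTime 3), ℂ), HasCompactSupport (F : (Fin (n + 1) → SpaceTime 3) → ℂ) → Tc F = 0 := by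
    intro F hFc
    set η₀ : Fin (n + 1) → SpaceTime 3 := fun k : Fin (n + 1) => (((k : ℕ) : ℝ) + 1) • e₀ 3 with hη₀
    have hη₀mem : η₀ ∈ tubeCone 3 (n + 1) := QuantumFieldTheory.stdDirection_mem_tubeCone
    have h := hray η₀ hη₀mem F hFc
    have hlim : Tendsto (fun t : ℝ => ∫ x : Fin (n + 1) → SpaceTime 3,
        Gc (fun k => complexifyPoint (x k) + ((t : ℂ) * I) • complexifyPoint (η₀ k)) * F x) (𝓝[>] 0) (𝓝 0) := by
      refine (tendsto_const_nhds (x := (0 : ℂ))).congr' ?_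
      filter_upwards [self_mem_nhdsWithin] with t ht
      refine (integral_eq_zero_of_ae (Eventually.of_forall fun x => ?_)).symm
      simp only [Pi.zero_apply, hG0 _ (mem_forwardTube_of_mem_tubeCone x η₀ hη₀mem ht), zero_mul]
    exact tendsto_nhds_unique h hlim
  have hTc0 : Tc = 0 := by
    ext F
    obtain ⟨u, hu, hlim⟩ := exists_hasCompactSupport_tendsto F
    have h1 : Tendsto (fun j => Tc (u j)) atTop (𝓝 (Tc F)) := (Tc.continuous.tendsto F).comp hlim
    have h2 : (fun j => Tc (u j)) = fun _ => 0 := funext fun j => hTc0' (u j) (hu j)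
    rw [h2] at h1
    exact tendsto_nhds_unique h1 tendsto_const_nhds
  have h := hTc_ten (Fin.cons f₀ f) _ (isTensorOf_tensorFin (Fin.cons f₀ f))
  simp only [Fin.cons_zero, Fin.cons_succ, hTc0, zero_apply] at h
  exact h.symm

/-- **Step 2 for combinations.** `X(f₀) φ(l) Ω = 0` for every monomial vector. [cite: StreaterWightman1964, §4-2 Thm 4-3] -/
theorem combField_cmonomialVec_eq_zero (hW : IsSpinorWightmanQFT W) (c : Fin m → ℂ) (i : Fin m → W.Idx)
    (hflag : ∀ a b, W.isFermi (i a).1 = W.isFermi (i b).1)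
    (h0 : ∀ g : 𝓢(SpaceTime 3, ℂ), W.combField c i g W.vacuumDom = 0) (f₀ : 𝓢(SpaceTime 3, ℂ))
    (l : List W.CLetter) : W.combField c i f₀ (W.cmonomialVec l) = 0 := by
  have hl : l = List.ofFn fun j : Fin l.length => ((l.get j).1, (l.get j).2) := by
    simp only [Prod.mk.eta, List.ofFn_get]
  rw [hl]
  apply Subtype.ext
  rw [Submodule.coe_zero, ← @inner_self_eq_zero ℂ]
  exact hW.inner_combField_cmonomialVec_eq_zero c i hflag h0 _ f₀ _ _

/-- The **adjoint combination** `X†(ḡ) = ∑ₐ c̄ₐ φ_{iₐ†}(ḡ)` and hermiticity: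
`⟪χ, X(f) ψ⟫ = ⟪X†(f̄) χ, ψ⟫`. [cite: StreaterWightman1964, §3-1] -/
theorem inner_combField (hW : IsSpinorWightmanQFT W) (c : Fin m → ℂ) (i : Fin m → W.Idx) (f : 𝓢(SpaceTime 3, ℂ))
    (ψ χ : W.dom) :
    ⟪(χ : W.H), (W.combField c i f ψ : W.H)⟫_ℂ =
      ⟪(W.combField (fun a => conj (c a)) (fun a => hW.adj (i a)) (starTest f) χ : W.H), (ψ : W.H)⟫_ℂ := by
  rw [combField_apply, combField_apply, Submodule.coe_sum, Submodule.coe_sum, inner_sum, sum_inner]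
  refine Finset.sum_congr rfl fun a _ => ?_
  rw [Submodule.coe_smul, Submodule.coe_smul, inner_smul_right, inner_smul_left, Complex.conj_conj, hW.inner_cfield,
    inner_conj_symm]

/-- **Step 3 for combinations.** If `X(g) Ω = 0` for all `g` then `X†(f̄) χ = 0` for `χ ∈ D`.
[cite: StreaterWightman1964, §4-2 Thm 4-3 eq. (4-12)] -/
theorem combField_adj_eq_zero (hW : IsSpinorWightmanQFT W) (c : Fin m → ℂ) (i : Fin m → W.Idx)
    (hflag : ∀ a b, W.isFermi (i a).1 = W.isFermi (i b).1)
    (h0 : ∀ g : 𝓢(SpaceTime 3, ℂ), W.combField c i g W.vacuumDom = 0) (f₀ : 𝓢(SpaceTime 3, ℂ)) (χ : W.dom) :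
    W.combField (fun a => conj (c a)) (fun a => hW.adj (i a)) (starTest f₀) χ = 0 := by
  have horth : ∀ l : List W.CLetter,
      ⟪(W.combField (fun a => conj (c a)) (fun a => hW.adj (i a)) (starTest f₀) χ : W.H), (W.cmonomialVec l : W.H)⟫_ℂ = 0 := by
    intro l
    rw [← hW.inner_combField c i f₀ (W.cmonomialVec l) χ, hW.combField_cmonomialVec_eq_zero c i hflag h0 f₀ l,
      Submodule.coe_zero, inner_zero_right]
  apply Subtype.ext
  rw [Submodule.coe_zero]
  refine hW.dense_span_cmonomialVec.eq_zero_of_inner_left ℂ fun v hv => ?_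
  induction hv using Submodule.span_induction with
  | mem v hv =>
    obtain ⟨l, rfl⟩ := hv
    exact horth l
  | zero => exact inner_zero_right _
  | add v v' _ _ hv hv' => rw [inner_add_right, hv, hv', add_zero]
  | smul c v _ hv => rw [inner_smul_right, hv, mul_zero]

/-- **A uniform-flag combination of components annihilating the vacuum vanishes**
(Streater–Wightman (1964), Thm. 4-3 for the field `X = ∑ cₐ φ_{iₐ}`): if `X(g) Ω = 0` for every
`g` then `X(f) = 0` on `D` for every `f`. [cite: StreaterWightman1964, §4-2 Thm 4-3] -/
theorem combField_eq_zero_of_vacuum_eq_zero (hW : IsSpinorWightmanQFT W) (c : Fin m → ℂ) (i : Fin m → W.Idx)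
    (hflag : ∀ a b, W.isFermi (i a).1 = W.isFermi (i b).1)
    (h0 : ∀ g : 𝓢(SpaceTime 3, ℂ), W.combField c i g W.vacuumDom = 0) (f₀ : 𝓢(SpaceTime 3, ℂ)) :
    W.combField c i f₀ = 0 := by
  refine LinearMap.ext fun ψ => Subtype.ext ?_
  rw [LinearMap.zero_apply, Submodule.coe_zero]
  have horth : ∀ χ : W.dom, ⟪(W.combField c i f₀ ψ : W.H), (χ : W.H)⟫_ℂ = 0 := by
    intro χ
    rw [← inner_conj_symm, hW.inner_combField c i f₀ ψ χ, hW.combField_adj_eq_zero c i hflag h0 f₀ χ,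
      Submodule.coe_zero, inner_zero_left, map_zero]
  refine hW.dense_dom.eq_zero_of_inner_left ℂ fun v hv => ?_
  exact horth ⟨v, hv⟩

end IsSpinorWightmanQFT

end Literature.Analysis.FunctionSpaces
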